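import Summits.CriticalPhenomena.CardyFormulaZ2.Theorems.CardyComplexConeParafermionToSLESixFamiliesDiamondExactPair
import Summits.CriticalPhenomena.CardyFormulaZ2.Theorems.CardyComplexConeParafermionToSLESixFamiliesIicTouchPassage
import Literature.Probability.LatticeModels.MedialWindingBridge
import HarnessLib

/-!
# The phase step of the corner observable across a forced-closed edge, and the chain increment of an exact
# pair at a touch site (line `potential-darboux-picard-diamond`, S1′ block structure)

Crux `ParafermionToSLESixFamilies` (stmt-CriticalPhenomena-11389), line `potential-darboux-picard-diamond`, stub
`stub_exactPotentialTracePh` (S1′), clauses (DIR)/(LOW) on a FREE side. Wave 1 found, by exact enumeration, the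
block structure of the boundary trace of the exact potential: at a touch site `u` of a free side, with the two edges
`e_{j+1}, e_{j+2}` at `u` ending on the dual-wired arc `B` (hence closed in every completed configuration), the three
corners `(u, j), (u, j+1), (u, j+2)` are passed by the exploration together, consecutively, with windings
`W, W + π/2, W + π` — so the chain increment of the face potential across `u` is `√3` times ONE corner term. This
file proves the exact, configuration-free part of that statement for an arbitrary admissible datum:

* `cornerOrbit_succ_of_closed`, `turnCount_succ_of_closed` — if the orbit passes a corner whose target edge is
  closed, the next corner is the next face around the same vertex and the turn count rises by one;
* `explorationPhase` / `cornerObs_eq_integral_orbitSum` — the integrand of `cornerObs E δ v (faceAt v j)` rewritten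
  on the orbit of the start corner: `∑_{k < exitTime, orb k = (v, j)} exp(-iπ/6 · turnCount k)` (dictionary
  `passesCornerAt_iff_cornerOrbit_eq`, winding `= (π/2)·turnCount` by `winding_orbitPts`);
* `cornerObs_faceAt_succ_of_closed` — **the phase step**: if `cTgt (u, j)` is closed in every completed
  configuration, `faceAt u (j+1)` is inner and `(u, j+1)` is not the start corner, then
  `cornerObs E δ u (faceAt u (j+1)) = e^{-iπ/6} · cornerObs E δ u (faceAt u j)` (exactly);
* `exactPair_chainIncrement` (registered, `--supports` the crux) — for an exact pair `(Φ, Ψ)` and such a site `u`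
  off both arcs with BOTH `cTgt (u, j)`, `cTgt (u, j+1)` forced closed:
  `Ψ (faceAt u (j+2)) - Ψ (faceAt u j) = classWeight (faceAt u j - u) · (1 + e^{-iπ/3}) · cornerObs E δ u (faceAt u j)`,
  a complex number of modulus `√3 · ‖cornerObs E δ u (faceAt u j)‖` in the direction `i^j e^{-iπ/6} · phase`.

What is NOT here: the determinism of the phase of `cornerObs E δ u (faceAt u j)` (the tree's
`Literature/…/MedialExplorationPrefixWinding.lean` supplies the tool; the closing path is diamond-specific).
-/

noncomputable section

namespace Summit.CriticalPhenomena.CardyFormulaZ2.Cruxes.ParafermionToSLESixFamilies.PotentialDarbouxPicardDiamond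

open scoped BigOperators
open MeasureTheory Filter Set Complex
open Literature.Probability Literature.Probability.LatticeModels Literature.Probability.Percolation
open Literature.Probability.LatticeModels.DiscreteDobrushin
open Literature.Probability.RandomPlanarGeometry
open Summit.CriticalPhenomena.CardyFormulaZ2.Cruxes.EdgePrecompact.QkzStripBoundaryArm (cornerObs)
open Summit.CriticalPhenomena.CardyFormulaZ2.Cruxes.ParafermionToSLESixFamilies.IicTraceFluxPairing
  (passesCornerAt_iff_cornerOrbit_eq)

variable {E : DiscreteDobrushin}

/-! ## One forced-closed step of the orbit -/

/-- Across a closed target edge the orbit moves to the next face around the same vertex. -/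
theorem cornerOrbit_succ_of_closed {β : BondConfig (Site 2)} {c₀ : Site 2 × Fin 4} {n : ℕ} {u : Site 2} {j : Fin 4}
    (hn : cornerOrbit β c₀ n = (u, j)) (hclosed : cTgt (u, j) ∉ β) : cornerOrbit β c₀ (n + 1) = (u, j + 1) := by
  change nextCorner β (cornerOrbit β c₀ n) = (u, j + 1)
  rw [hn, nextCorner_of_not_mem hclosed]

/-- Across a closed target edge the turn count rises by one (a left turn). -/
theorem turnCount_succ_of_closed {β : BondConfig (Site 2)} {c₀ : Site 2 × Fin 4} {n : ℕ} {u : Site 2} {j : Fin 4}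
    (hn : cornerOrbit β c₀ n = (u, j)) (hclosed : cTgt (u, j) ∉ β) : turnCount β c₀ (n + 1) = turnCount β c₀ n + 1 := by
  rw [turnCount_succ, hn, turnSign_of_not_mem hclosed]

/-- The orbit corner BEFORE a visit to `(u, j + 1)` is `(u, j)` when the edge between the two faces is closed
(injectivity of the turning rule). -/
theorem cornerOrbit_pred_of_closed {β : BondConfig (Site 2)} {c₀ : Site 2 × Fin 4} {n : ℕ} {u : Site 2} {j : Fin 4}
    (hn : cornerOrbit β c₀ (n + 1) = (u, j + 1)) (hclosed : cTgt (u, j) ∉ β) : cornerOrbit β c₀ n = (u, j) := by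
  apply nextCorner_injective (β := β)
  change cornerOrbit β c₀ (n + 1) = nextCorner β (u, j)
  rw [hn, nextCorner_of_not_mem hclosed]

/-! ## The integrand of the corner observable on the orbit -/

/-- The winding of the exploration prefix ending with the `k`-th dart, `k < exitTime`, is `(π/2) · turnCount k`. -/
theorem winding_take_medialExploration (hE : E.IsZdAdmissible) {δ : ℝ} (hδ : δ ≠ 0) (ω : BondConfig (Site 2)) {k : ℕ}
    (hk : k < exitTime hE ω) :
    Literature.Probability.LatticeModels.Polyline.winding (((medialExploration E ω).map (medialPoint δ)).take (k + 2)) =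
      Real.pi / 2 * turnCount (E.bcBondConfig ω) (startCorner hE) k := by
  rw [Polyline.winding_eq_winding, medialExploration_eq_explorationList hE ω, map_medialPoint_explorationList,
    take_orbitPts δ _ (Nat.succ_le_of_lt hk), winding_orbitPts hδ, Nat.succ_sub_one, sum_turnOf_eq, turnCount]
  push_cast
  rfl

/-- **The integrand of the corner observable on the orbit.** For admissible data and `δ ≠ 0`, the random variable
integrated by `cornerObs E δ v (faceAt v j)` is `∑_{k < exitTime, orb k = (v, j)} exp(-iπ/6 · turnCount k)`. -/
theorem cornerObs_integrand_eq (hE : E.IsZdAdmissible) {δ : ℝ} (hδ : δ ≠ 0) (v : Site 2) (j : Fin 4)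
    (ω : BondConfig (Site 2)) :
    (∑ k ∈ (Finset.range (medialExploration E ω).length).filter (fun k =>
        (medialExploration E ω)[k]? = some (cornerSource v (faceAt v j)) ∧
          (medialExploration E ω)[k + 1]? = some (cornerTarget v (faceAt v j))),
        Complex.exp (-(Complex.I / 3) * ((Literature.Probability.LatticeModels.Polyline.winding
          (((medialExploration E ω).map (medialPoint δ)).take (k + 2)) : ℝ) : ℂ))) =
      ∑ k ∈ (Finset.range (exitTime hE ω)).filter
          (fun k => cornerOrbit (E.bcBondConfig ω) (startCorner hE) k = (v, j)),
        Complex.exp (-(Real.pi / 6 * turnCount (E.bcBondConfig ω) (startCorner hE) k : ℝ) * I) := by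
  have hlen : (medialExploration E ω).length = exitTime hE ω + 1 := by
    rw [medialExploration_eq_explorationList hE ω, length_explorationList']
  have hfilter : (Finset.range (medialExploration E ω).length).filter (fun k =>
        (medialExploration E ω)[k]? = some (cornerSource v (faceAt v j)) ∧
          (medialExploration E ω)[k + 1]? = some (cornerTarget v (faceAt v j))) =
      (Finset.range (exitTime hE ω)).filter
          (fun k => cornerOrbit (E.bcBondConfig ω) (startCorner hE) k = (v, j)) := by
    ext k
    simp only [Finset.mem_filter, Finset.mem_range, passesCornerAt_iff_cornerOrbit_eq hE ω v j k, hlen]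
    constructor
    · rintro ⟨-, hk, h⟩; exact ⟨hk, h⟩
    · rintro ⟨hk, h⟩; exact ⟨by omega, hk, h⟩
  rw [hfilter]
  refine Finset.sum_congr rfl fun k hk => ?_
  rw [Finset.mem_filter, Finset.mem_range] at hk
  rw [winding_take_medialExploration hE hδ ω hk.1]
  congr 1
  push_cast
  ring

/-! ## The phase step across a forced-closed edge -/

/-- **The visits of `(u, j+1)` are the visits of `(u, j)` shifted by one step**, when `cTgt (u, j)` is closed,
`faceAt u (j+1)` is inner and `(u, j+1)` is not the start corner. -/
theorem filter_orbit_succ_eq_image (hE : E.IsZdAdmissible) (ω : BondConfig (Site 2)) {u : Site 2} {j : Fin 4}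
    (hclosed : cTgt (u, j) ∉ E.bcBondConfig ω) (hinner : E.IsInnerFace (faceAt u (j + 1)))
    (hstart : startCorner hE ≠ (u, j + 1)) :
    (Finset.range (exitTime hE ω)).filter
        (fun k => cornerOrbit (E.bcBondConfig ω) (startCorner hE) k = (u, j + 1)) =
      ((Finset.range (exitTime hE ω)).filter
        (fun k => cornerOrbit (E.bcBondConfig ω) (startCorner hE) k = (u, j))).image (· + 1) := by
  ext k'
  simp only [Finset.mem_filter, Finset.mem_range, Finset.mem_image]
  constructor
  · rintro ⟨hk', horb⟩
    obtain ⟨k, rfl⟩ : ∃ k, k' = k + 1 := by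
      rcases k' with _ | k
      · exact absurd horb hstart
      · exact ⟨k, rfl⟩
    exact ⟨k, ⟨by omega, cornerOrbit_pred_of_closed horb hclosed⟩, rfl⟩
  · rintro ⟨k, ⟨hk, horb⟩, rfl⟩
    have hsucc := cornerOrbit_succ_of_closed horb hclosed
    refine ⟨?_, hsucc⟩
    -- `k + 1` is before the exit: its face is inner
    rcases Nat.lt_or_ge (k + 1) (exitTime hE ω) with h | h
    · exact h
    · exfalso
      have hk1 : k + 1 = exitTime hE ω := by omega
      have := not_isInnerFace_exitTime hE ω
      rw [← hk1, hsucc] at this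
      exact this hinner

/-- **The phase step of the corner observable across a forced-closed edge.** For admissible data, `δ ≠ 0`, a
vertex `u` and a face index `j` such that the edge `cTgt (u, j)` (between the faces `j` and `j + 1` at `u`) is
closed in every completed configuration, the face `faceAt u (j+1)` is inner, and `(u, j+1)` is not the start corner:
`cornerObs E δ u (faceAt u (j+1)) = e^{-iπ/6} · cornerObs E δ u (faceAt u j)`. (Every visit of `(u, j)` is followed
by the visit of `(u, j+1)`, one left quarter-turn later, and conversely.) -/
theorem cornerObs_faceAt_succ_of_closed (hE : E.IsZdAdmissible) {δ : ℝ} (hδ : δ ≠ 0) {u : Site 2} {j : Fin 4}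
    (hclosed : ∀ ω, cTgt (u, j) ∉ E.bcBondConfig ω) (hinner : E.IsInnerFace (faceAt u (j + 1)))
    (hstart : startCorner hE ≠ (u, j + 1)) :
    cornerObs E δ u (faceAt u (j + 1)) = Complex.exp (-(Real.pi / 6 : ℝ) * I) * cornerObs E δ u (faceAt u j) := by
  unfold cornerObs
  -- buildfix 2026-08-20 (proof-only, regime-robust): `cornerObs` spells the fully-qualified
  -- `Literature.Probability.LatticeModels.winding` (= `FermionicObservable`'s copy whenever that module is in
  -- the closure); realign it with the `Polyline.winding` of this file's lemmas (`MedialWindingBridge`; a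
  -- syntactic identity once the Literature dedupe lands).
  rw [← Literature.Probability.LatticeModels.Polyline.winding_eq_winding']
  rw [← integral_const_mul]
  refine integral_congr_ae (Eventually.of_forall fun ω => ?_)
  simp only
  rw [cornerObs_integrand_eq hE hδ u (j + 1) ω, cornerObs_integrand_eq hE hδ u j ω,
    filter_orbit_succ_eq_image hE ω (hclosed ω) hinner hstart, Finset.sum_image fun a _ b _ h => by simpa using h,
    Finset.mul_sum]
  refine Finset.sum_congr rfl fun k hk => ?_
  rw [Finset.mem_filter] at hk
  rw [turnCount_succ_of_closed hk.2 (hclosed ω), ← Complex.exp_add]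
  congr 1
  push_cast
  ring

/-- Two forced-closed steps: `cornerObs E δ u (faceAt u (j+2)) = e^{-iπ/3} · cornerObs E δ u (faceAt u j)`. -/
theorem cornerObs_faceAt_add_two_of_closed (hE : E.IsZdAdmissible) {δ : ℝ} (hδ : δ ≠ 0) {u : Site 2} {j : Fin 4}
    (hclosed : ∀ ω, cTgt (u, j) ∉ E.bcBondConfig ω) (hclosed' : ∀ ω, cTgt (u, j + 1) ∉ E.bcBondConfig ω)
    (hinner : E.IsInnerFace (faceAt u (j + 1))) (hinner' : E.IsInnerFace (faceAt u (j + 2)))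
    (hstart : startCorner hE ≠ (u, j + 1)) (hstart' : startCorner hE ≠ (u, j + 2)) :
    cornerObs E δ u (faceAt u (j + 2)) = Complex.exp (-(Real.pi / 3 : ℝ) * I) * cornerObs E δ u (faceAt u j) := by
  have h2 : j + 2 = j + 1 + 1 := (fin4_add_one_add_one j).symm
  rw [h2, cornerObs_faceAt_succ_of_closed hE hδ hclosed' (h2 ▸ hinner') (h2 ▸ hstart'),
    cornerObs_faceAt_succ_of_closed hE hδ hclosed hinner hstart, ← mul_assoc, ← Complex.exp_add]
  congr 2
  push_cast
  ring

/-! ## The chain increment of an exact pair at a touch site -/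

/-- The three phases add up: `1 + e^{-iπ/3} = √3 · e^{-iπ/6}` (so the chain increment has modulus `√3·‖E‖`). -/
theorem one_add_exp_neg_pi_div_three :
    (1 : ℂ) + Complex.exp (-(Real.pi / 3 : ℝ) * I) = (Real.sqrt 3 : ℂ) * Complex.exp (-(Real.pi / 6 : ℝ) * I) := by
  have h1 : Complex.exp (-(Real.pi / 3 : ℝ) * I) = Complex.exp (-(Real.pi / 6 : ℝ) * I) * Complex.exp (-(Real.pi / 6 : ℝ) * I) := by
    rw [← Complex.exp_add]; congr 1; push_cast; ring
  have h2 : (1 : ℂ) = Complex.exp (-(Real.pi / 6 : ℝ) * I) * Complex.exp ((Real.pi / 6 : ℝ) * I) := by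
    rw [← Complex.exp_add]; convert Complex.exp_zero.symm using 2; push_cast; ring
  have hcos : Complex.exp ((Real.pi / 6 : ℝ) * I) + Complex.exp (-(Real.pi / 6 : ℝ) * I) = (Real.sqrt 3 : ℂ) := by
    rw [show (-(Real.pi / 6 : ℝ) : ℂ) * I = -((Real.pi / 6 : ℝ) : ℂ) * I by push_cast; ring]
    have := Complex.cos_add_sin_I ((Real.pi / 6 : ℝ) : ℂ)
    rw [← Complex.two_cos, ← Complex.ofReal_cos, Real.cos_pi_div_six]
    push_cast; ring
  rw [h1, h2, ← mul_add, mul_comm, hcos]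

/-- **The chain increment of an exact pair at a touch site** (registered helper of `stub_exactPotentialTracePh`).
For the admissible datum `E` read at mesh `E.δ`, an exact pair `(Φ, Ψ)`, a site `u` off both discrete arcs and a
face index `j` such that the target edges of `(u, j)` and `(u, j+1)` are closed in every completed configuration
(on a free side: their far endpoints lie on the dual-wired arc), the faces `j+1, j+2` at `u` are inner and `(u, j)`
has an inner face too: the face potential steps across `u` by
`Ψ (faceAt u (j+2)) - Ψ (faceAt u j) = classWeight (faceAt u j - u) · (1 + e^{-iπ/3}) · cornerObs E E.δ u (faceAt u j)`. -/
theorem exactPair_chainIncrement : ∀ (E : DiscreteDobrushin) (hE : E.IsZdAdmissible) (Φ Ψ : Site 2 → ℂ), IsExactPair E E.δ Φ Ψ → ∀ (u : Site 2) (j : Fin 4), u ∉ E.zdArcA → u ∉ E.zdArcB → (∀ ω : BondConfig (Site 2), cTgt (u, j) ∉ E.bcBondConfig ω) → (∀ ω : BondConfig (Site 2), cTgt (u, j + 1) ∉ E.bcBondConfig ω) → E.IsInnerFace (faceAt u j) → E.IsInnerFace (faceAt u (j + 1)) → E.IsInnerFace (faceAt u (j + 2)) → Ψ (faceAt u (j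 + 2)) - Ψ (faceAt u j) = classWeight (faceAt u j - u) * (1 + Complex.exp (-(Real.pi / 3 : ℝ) * I)) * cornerObs E E.δ u (faceAt u j) := by
  intro E hE Φ Ψ hP u j huA huB hclosed hclosed' hinner0 hinner hinner'
  have hδ : E.δ ≠ 0 := hE.delta_pos.ne'
  -- `u` is off the arc `A`, so no corner at `u` is the start corner
  have hstart : ∀ i : Fin 4, startCorner hE ≠ (u, i) := fun i h =>
    huA (by have := (isStartCorner_startCorner hE).mem_zdArcA; rwa [h] at this)
  have h0 := hP u (faceAt u j) (isCorner_faceAt u j) hinner0 huA huB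
  have h2 := hP u (faceAt u (j + 2)) (isCorner_faceAt u (j + 2)) hinner' huA huB
  have hobs := cornerObs_faceAt_add_two_of_closed hE hδ hclosed hclosed' hinner hinner' (hstart _) (hstart _)
  have hw : classWeight (faceAt u (j + 2) - u) = -classWeight (faceAt u j - u) := by
    rw [faceAt, faceAt, sub_sub_cancel_left, sub_sub_cancel_left, classWeight_neg_cornerOff_add_two]
  -- `Ψ f = Φ u - w E`
  have e0 : Ψ (faceAt u j) = Φ u - classWeight (faceAt u j - u) * cornerObs E E.δ u (faceAt u j) := by
    rw [← h0]; ring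
  have e2 : Ψ (faceAt u (j + 2)) = Φ u - classWeight (faceAt u (j + 2) - u) * cornerObs E E.δ u (faceAt u (j + 2)) := by
    rw [← h2]; ring
  rw [e0, e2, hw, hobs]
  ring

end Summit.CriticalPhenomena.CardyFormulaZ2.Cruxes.ParafermionToSLESixFamilies.PotentialDarbouxPicardDiamond

end
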